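import Literature.AlgebraicGeometry.Resolution.PointBlowupPackageBound
import Literature.AlgebraicGeometry.Resolution.PointBlowupFlagTranslatedStep
import Literature.AlgebraicGeometry.Resolution.PointBlowupHauserConditions
import Literature.AlgebraicGeometry.Resolution.PointBlowupShadeCentres
import HarnessLib

/-!
# Hauser's oasis–antelope bound: between the oasis point and the antelope point of a kangaroo
# point the shade drops at least to half — `shade_a f ≤ ⌊½·shade_{a°} f°⌋` (surfaces, order `p`)

Topic: `Literature/AlgebraicGeometry/Resolution`. Model theorem (cell `res-hironaka`, D-0124 RESCUE,
catalogue row RR-153 / harvest card B-036; seat res-type-048 on the booked T1 typing hand's split,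
HOME/STATUS 2026-08-27T08:03:37Z) for

* H. Hauser, *On the problem of resolution of singularities in positive characteristic (Or: a proof
  we are still waiting for)*, Bull. AMS **47** (2010) 1–30 [Hauser2010], §J p. 24 (held text
  `paper:url-e05f9797908d` p0024; = H. Hauser, *Kangaroo points and oblique polynomials in resolution of
  positive characteristic*, arXiv:0811.4151, §F p. 9 L18–L24): "given a sequence of point blowups in
  a three dimensional ambient space for which the subsequent centers are equiconstant points for some
  `f`, call *antelope point* the point `a` immediately prior to a kangaroo point `a'`, and *oasis
  point* the last point `a°` below `a` where none of the exceptional components through `a` has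
  appeared yet. The following is then a nice exercise: **Fact.** *The shade of `f` drops between the
  oasis point `a°` and the antelope point `a` of a kangaroo point `a'` at least to the integer part
  of its half, `shade_a f ≤ ⌊½·shade_{a°} f°⌋`.*" (In print the Fact is attributed to the
  unpublished [Ha1]; the tree types it as the predicate `Hauser2010.OasisBound`
  (`PointBlowupShadeCentres.lean`) and lists it among the statements "not vendored (missing
  infrastructure)" in `Hauser2010.lean`. This file PROVES it in the tree's point-blow-up model.)

## The model and the shape of an oasis–antelope window

The model is that of `PointBlowupShade.lean` (fixed coordinates; states `s = (F, r)` of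
`x^q + F(y)`, `step q j b` = chart `y_j`, translation to the point `b`, deletion of the `q`-th power
monomials; exceptional multiplicities `newMult`; `shade = ord₀ F − |r|`), with TWO residual letters
`j₁ ≠ j'` (surfaces in three-space). In this model the window from an oasis to its antelope point has
a FORCED shape. At the antelope point both exceptional multiplicities are prime to `p`
(`PointBlowup.lostComponents_eq_univ_of_shadeIncreases`: an increase of the shade loses both
components and needs `p ∤ r_i` for both), in particular both components `{y_{j₁} = 0}`, `{y_{j'} = 0}`
pass through the antelope point `a`. The one created first — at the first blow-up after the oasis,
read in ITS chart `y_{j₁}`, at a point `b` of the new exceptional divisor (`b_{j₁} = 0`, `b_{j'}`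
arbitrary) — must survive every later blow-up, so every later blow-up is read in the OTHER chart
`y_{j'}` at a point with `b_{j₁} = 0`, and with `b_{j'} = 0` as well since the centres lie on the
newest exceptional divisor: all later blow-ups are blow-ups of the ORIGIN of the `y_{j'}`-chart. A
window of length one is impossible (the second component through `a` would then predate the oasis).
Hence: **oasis `s 0` —[chart `j₁`, point `b`, `b_{j₁} = 0`]→ `s 1` —[chart `j'`, origin]→ `s 2` → ⋯
—[chart `j'`, origin]→ `s m` = antelope, `m ≥ 2`**, and this file states the theorems for exactly
such windows (hypotheses on a sequence `s : ℕ → State σ K`).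

## What is proved (every field `K`; the cleaning parameter `q` arbitrary in the main inequality)

* `PointBlowup.mul_shade_le_shade_of_window` — the QUANTITATIVE form: along such a window of length
  `m ≥ 2`, with `y^{r} ∣ F` at the start, order `≥ q` at `s 0, …, s m`, and `q ∤ r_{j₁}(s m)` (the
  multiplicity of the component born at the first step), one has **`m · shade(s m) ≤ shade(s 0)`**.
  No characteristic hypothesis is needed for this statement.
* `PointBlowup.shade_antelope_le_half_shade_oasis` — **Hauser's Fact** in the model: for `q = p`
  prime, `char K = p`, two residual letters, a window as above whose steps are equimultiple
  (equiconstant) points and whose end `s m` is an antelope point (some kangaroo point lies above it,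
  `PointBlowup.IsKangarooPoint`), `Hauser2010.OasisBound (s 0).shade (s m).shade`, i.e.
  `2 · shade(s m) ≤ shade(s 0)`; the divisibility hypothesis of the quantitative form is supplied by
  the Kangaroo Theorem's bookkeeping (`lostComponents_eq_univ_of_shadeIncreases`).

## Proof (ours — the printed source gives none; "a nice exercise")

Write `A := ord₀ F₀ − q` (the multiplicity of the component `{y_{j₁} = 0}` born at the first step; it
is `r_{j₁}(s n)` for every `1 ≤ n ≤ m`) and `F₁` for the residual polynomial of `s 1`. The later steps
are blow-ups of the origin of the `y_{j'}`-chart, which the tree has monomialised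
(`PointBlowupPackageBound.lean`, [HauserPerlega2024] §4 p. 781): `F_{n+1} = F₁^{(n)}`
(`package_prefix`), `ord₀ F₁^{(n)} = W_{n+1} − n·q` with `W_k := min_{d ∈ supp F₁} (d_{j'} + k·d_{j₁})`
the least package weight (`ordZero_pkgTransform`), and `r_{j'}(s m) = ord₀ F_{m−1} − q`. Hence
`shade(s m) = W_m − W_{m−1} − A`. The function `k ↦ W_k` is a minimum of affine functions, so it is
CONCAVE: choosing `d*` with `W_{m−1} = d*_{j'} + (m−1)·d*_{j₁}` gives `W_m ≤ W_{m−1} + d*_{j₁}`, whence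
`m·(W_m − W_{m−1} − A) ≤ W_m − d*_{j'} − m·A`. Finally the column `d_{j₁} = A` of `F₁`: it is the
transform of the INITIAL FORM of `F₀` translated by `b` (the layer lemma
`exists_mem_support_translate_layer` of `PointBlowupMohBound.lean`), it is untouched by the cleaning
because `q ∤ A`, and so it contains an exponent `E` with `E_{j'} ≤ r_{j'}(s 1) + shade(s 0)`; then
`W_m ≤ E_{j'} + m·A` and `r_{j'}(s 1) ≤ d*_{j'}` (`y^{r(s 1)} ∣ F₁`) give `m·shade(s m) ≤ shade(s 0)`.
On Hauser's example of §K (`x² + y⁷ + yz⁴`: oasis shade `5`, two blow-ups, antelope shade `2`) the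
bound `2·2 ≤ 5` is attained up to rounding.

## What is NOT proved here (scope, honest)

* The notions "oasis / antelope / kangaroo point OF A RUN" are not given as definitions on runs; the
  theorems quantify over windows of the forced shape described above (the reduction of an arbitrary
  run to this shape is the two-line bookkeeping argument of the previous section, recorded in prose).
* Nothing for more than two residual letters ("It seems challenging to establish a similar statement
  for singular three-folds in four-space", [Hauser2010] §J; cf. `KangarooAtlasCertCentres.lean`,
  Bérczi's threefold walk, where the surface compensation fails).
* Nothing here is a statement about resolution of singularities in characteristic `p`; model
  theorem only (the kernel `KangarooShadeIncrease` of `Literature/Barriers/…` is the opposite-direction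
  fact: the shade DOES increase at the kangaroo point).
-/

noncomputable section

open MvPolynomial Finset

open scoped BigOperators

namespace Literature.AlgebraicGeometry.Resolution

open Literature.AlgebraicGeometry.Resolution.Hauser2010
open Literature.Barriers.ResolutionOfSingularities
open Literature.AlgebraicGeometry.Resolution.HauserPerlega2024
  (degree_eq_two support_chartTransform chartTransform_zero)

namespace PointBlowup

variable {σ : Type*} {K : Type*} [Field K] [Fintype σ] [DecidableEq σ] [DecidableEq K]

/-! ## 1. Two-letter bookkeeping -/

omit [Fintype σ] [DecidableEq σ] [DecidableEq K] in
/-- With two letters `j₁ ≠ j'`, a pointwise comparison. [folklore] -/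
private theorem le_of_two {j₁ j' : σ} (hσ : ∀ l, l = j₁ ∨ l = j') {ρ e : σ →₀ ℕ}
    (h₁ : ρ j₁ ≤ e j₁) (h' : ρ j' ≤ e j') : ρ ≤ e := by
  rw [Finsupp.le_def]
  intro l
  rcases hσ l with rfl | rfl
  exacts [h₁, h']

/-- Linear core of the window arithmetic, all products pre-named. [folklore] -/
private theorem window_arith_lin {S X1 I KS P MS MA Wm Wm1 y yE r σ₀ A : ℕ}
    (hS : Wm = Wm1 + A + S) (hmS : MS = KS + S) (hprod : KS ≤ P) (hxA : P = X1 - I)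
    (hmono : I ≤ X1) (hmA : MA = I + A) (hK1 : Wm ≤ yE + MA) (hW1 : Wm1 = y + X1)
    (hK4 : r ≤ y) (hcol : yE ≤ r + σ₀) : MS ≤ σ₀ := by
  omega

/-- The arithmetic of the window bound (concavity of the least package weight `k ↦ W_k` in the
number `k` of origin blow-ups, in the form needed): with `W_{m−1} = y + (m−1)·x` attained at an
exponent `(x, y)`, `W_m ≤ y + m·x`, `W_m ≤ y_E + m·A` (the column exponent), `r ≤ y`,
`y_E ≤ r + σ₀` and `(m−1)·q ≤ W_{m−1}`, the natural number
`m · ((W_m − (m−1)q) − (A + (W_{m−1} − (m−2)q − q)))` is at most `σ₀`. [folklore] -/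
private theorem window_arith {m q A Wm Wm1 x y yE r σ₀ : ℕ} (hm : 2 ≤ m)
    (hW1 : Wm1 = y + (m - 1) * x) (hK3 : Wm ≤ y + m * x) (hK1 : Wm ≤ yE + m * A)
    (hK4 : r ≤ y) (hcol : yE ≤ r + σ₀) (hwt : (m - 1) * q ≤ Wm1) :
    m * (Wm - (m - 1) * q - (A + (Wm1 - (m - 2) * q - q))) ≤ σ₀ := by
  have h2 : (m - 2) * q + q = (m - 1) * q := by
    rw [show m - 1 = (m - 2) + 1 by omega, Nat.succ_mul]
  have h3 : Wm1 - (m - 2) * q - q = Wm1 - (m - 1) * q := by rw [Nat.sub_sub, h2]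
  rw [h3]
  have hSeq : Wm - (m - 1) * q - (A + (Wm1 - (m - 1) * q)) = Wm - Wm1 - A := by omega
  rw [hSeq]
  by_cases hS0 : Wm - Wm1 - A = 0
  · rw [hS0, mul_zero]
    exact Nat.zero_le _
  have hSpos : 0 < Wm - Wm1 - A := Nat.pos_of_ne_zero hS0
  have hWm : Wm = Wm1 + A + (Wm - Wm1 - A) := by omega
  have hmx : m * x = (m - 1) * x + x := by
    conv_lhs => rw [show m = (m - 1) + 1 by omega]
    rw [Nat.succ_mul]
  have hmA : m * A = (m - 1) * A + A := by
    conv_lhs => rw [show m = (m - 1) + 1 by omega]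
    rw [Nat.succ_mul]
  have hmS : m * (Wm - Wm1 - A) = (m - 1) * (Wm - Wm1 - A) + (Wm - Wm1 - A) := by
    conv_lhs => rw [show m = (m - 1) + 1 by omega]
    rw [Nat.succ_mul]
  have hle : Wm - Wm1 - A ≤ x - A := by omega
  have hAx : A ≤ x := (Nat.lt_of_sub_pos (lt_of_lt_of_le hSpos hle)).le
  have hprod : (m - 1) * (Wm - Wm1 - A) ≤ (m - 1) * (x - A) := Nat.mul_le_mul_left _ hle
  have hxA : (m - 1) * (x - A) = (m - 1) * x - (m - 1) * A := Nat.mul_sub _ _ _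
  have hmono : (m - 1) * A ≤ (m - 1) * x := Nat.mul_le_mul_left _ hAx
  exact window_arith_lin hWm hmS hprod hxA hmono hmA hK1 hW1 hK4 hcol

/-! ## 2. The quantitative window bound: `m · shade(s m) ≤ shade(s 0)` -/

/-- **The oasis–antelope window bound, quantitative form** (ours; the mechanism behind [Hauser2010]
§J "Fact"). Two residual letters `j₁ ≠ j'`; a sequence of states `s` with `s 1 = step q j₁ b (s 0)`
(`b_{j₁} = 0`: a point of the new exceptional divisor, `b_{j'}` arbitrary) and
`s (n+1) = step q j' 0 (s n)` for `1 ≤ n < m` (blow-ups of the origin of the other chart), `m ≥ 2`;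
`y^{r} ∣ F` at `s 0`; order `≥ q` at `s 0, …, s m`; and `q ∤ r_{j₁}(s m)`. Then
**`m · shade(s m) ≤ shade(s 0)`** in `ℕ∞`. No characteristic hypothesis. Proof: package
monomialisation of the origin steps (`package_prefix`, `ordZero_pkgTransform`), concavity of the least
package weight in the number of steps, and the layer lemma for the translated first step — see the
module docstring. [cite: Hauser2010, §J p. 24 (Fact)] [cite: HauserPerlega2024, §4 p. 781 (monomialised point blowups)] -/
theorem mul_shade_le_shade_of_window (q : ℕ) {j₁ j' : σ} (hne : j₁ ≠ j')
    (hσ : ∀ l, l = j₁ ∨ l = j') (s : ℕ → State σ K) (b : σ → K) (hb : b j₁ = 0) {m : ℕ}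
    (hm : 2 ≤ m) (h1 : s 1 = step q j₁ b (s 0))
    (hstep : ∀ n, 1 ≤ n → n < m → s (n + 1) = step q j' 0 (s n))
    (hord : ∀ n, n ≤ m → (q : ℕ∞) ≤ ordZero (s n).F)
    (hr : ∀ d ∈ (s 0).F.support, (s 0).r ≤ d) (hq : ¬ q ∣ (s m).r j₁) :
    (m : ℕ∞) * (s m).shade ≤ (s 0).shade := by
  classical
  have hσ' : ∀ l, l = j' ∨ l = j₁ := fun l => (hσ l).symm
  -- the degenerate start `F₀ = 0`
  by_cases hF0 : (s 0).F = 0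
  · have : (s 0).shade = ⊤ := by
      unfold State.shade
      rw [hF0, ordZero_zero, ENat.top_sub_coe]
    rw [this]
    exact le_top
  -- the natural order `o₀ ≥ q` of `F₀`, `A := o₀ − q`, the natural shade `σ₀`
  have hne0 : ordZero (s 0).F ≠ ⊤ := by
    unfold ordZero
    rw [Ne, MvPowerSeries.order_eq_top_iff, MvPolynomial.coe_eq_zero_iff]
    exact hF0
  obtain ⟨o₀, ho₀'⟩ := WithTop.ne_top_iff_exists.mp hne0
  have ho₀ : ordZero (s 0).F = o₀ := ho₀'.symm
  have hqo₀ : q ≤ o₀ := by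
    have h := hord 0 (by omega)
    rw [ho₀] at h
    exact_mod_cast h
  have hdeg0 : ∀ d ∈ (s 0).F.support, o₀ ≤ d.degree := le_degree_of_ordZero_eq (s 0) ho₀
  have hdegq : ∀ d ∈ (s 0).F.support, q ≤ d.degree := fun d hd => hqo₀.trans (hdeg0 d hd)
  obtain ⟨⟨d₀, hd₀, hd₀deg⟩, -⟩ := (ordZero_eq_nat_iff _ _).mp ho₀
  have hd₀s : d₀ ∈ (s 0).F.support := MvPolynomial.mem_support_iff.mpr hd₀
  have hrd₀ : (s 0).r ≤ d₀ := hr d₀ hd₀s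
  have hr₁d₀ : (s 0).r j₁ ≤ d₀ j₁ := Finsupp.le_def.mp hrd₀ j₁
  have hr'd₀ : (s 0).r j' ≤ d₀ j' := Finsupp.le_def.mp hrd₀ j'
  have hd₀two : d₀.degree = d₀ j₁ + d₀ j' := degree_eq_two hne hσ d₀
  have hr0two : (s 0).r.degree = (s 0).r j₁ + (s 0).r j' := degree_eq_two hne hσ (s 0).r
  have hshade0 : (s 0).shade = ((o₀ - (s 0).r.degree : ℕ) : ℕ∞) := shade_eq_of_ordZero_eq _ ho₀
  set A : ℕ := o₀ - q with hA
  -- ### step 1: the residual polynomial and the multiplicities of `s 1`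
  set P : MvPolynomial σ K := chartTransform q j₁ (s 0).F with hP
  have hF1 : (s 1).F = deletePthPowers q (translate b P) := by rw [h1]; rfl
  have hr1 : (s 1).r = ((s 0).r.update j₁ (o₀ - q)).filter (fun i => b i = 0) := by
    rw [h1]; exact newMult_eq q j₁ b hb (s 0) ho₀
  have hr1j₁ : (s 1).r j₁ = A := by
    rw [hr1, Finsupp.filter_apply, if_pos hb, Finsupp.update_apply, if_pos rfl]
  have hr1le : ∀ E ∈ (s 1).F.support, (s 1).r ≤ E := by
    rw [h1]; exact newMult_le_of_mem_support_step q j₁ b hb (s 0) ho₀ hr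
  have hr1two : (s 1).r.degree = (s 1).r j₁ + (s 1).r j' := degree_eq_two hne hσ (s 1).r
  -- the support of the chart transform
  have hPsupp : P.support = (s 0).F.support.image (chartExponent q j₁) :=
    support_chartTransform q j₁ hdegq
  -- ### the column `E_{j₁} = A` of `F₁` (layer lemma for the translated chart transform)
  set ρ : σ →₀ ℕ := (s 0).r.update j₁ A with hρ
  have hρj₁ : ρ j₁ = A := by rw [hρ, Finsupp.update_apply, if_pos rfl]
  have hρj' : ρ j' = (s 0).r j' := by rw [hρ, Finsupp.update_apply, if_neg hne.symm]
  have hρle : ∀ e ∈ P.support, ρ ≤ e := by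
    intro e he
    rw [hPsupp, Finset.mem_image] at he
    obtain ⟨d, hd, rfl⟩ := he
    refine le_of_two hσ ?_ ?_
    · rw [hρj₁, chartExponent_apply, if_pos rfl]
      exact Nat.sub_le_sub_right (hdeg0 d hd) q
    · rw [hρj', chartExponent_apply, if_neg hne.symm]
      exact Finsupp.le_def.mp (hr d hd) j'
  have hρD : ∀ e ∈ P.support, e j₁ = ρ j₁ → e.degree ≤ ρ.degree + (o₀ - (s 0).r.degree) := by
    intro e he hej
    rw [hPsupp, Finset.mem_image] at he
    obtain ⟨d, hd, rfl⟩ := he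
    rw [chartExponent_apply, if_pos rfl, hρj₁] at hej
    have hdd : d.degree = o₀ := by have := hdeg0 d hd; omega
    have hdj₁ : (s 0).r j₁ ≤ d j₁ := Finsupp.le_def.mp (hr d hd) j₁
    have hdtwo : d.degree = d j₁ + d j' := degree_eq_two hne hσ d
    rw [degree_chartExponent, degree_eq_two hne hσ ρ, hρj₁, hρj', hr0two]
    omega
  have hlayer : ∃ e ∈ P.support, e j₁ = ρ j₁ :=
    ⟨chartExponent q j₁ d₀, by rw [hPsupp]; exact Finset.mem_image_of_mem _ hd₀s, by
      rw [chartExponent_apply, if_pos rfl, hρj₁, hd₀deg]⟩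
  obtain ⟨E, hEt, hEj₁, hEdeg⟩ :=
    exists_mem_support_translate_layer b hb P ρ hρle (o₀ - (s 0).r.degree) hρD hlayer
  rw [hρj₁] at hEj₁
  have hρfilter : ρ.filter (fun i => b i = 0) = (s 1).r := by rw [hr1]
  rw [hρfilter] at hEdeg
  -- ### the package `s 1 → s 2 → ⋯ → s m` at the origin of the `y_{j'}`-chart
  have hpkg := package_prefix q j' m (fun n => s (n + 1))
    (fun n hn => hstep (n + 1) (by omega) (by omega))
    (by rw [h1]; exact deletePthPowers_step q j₁ b (s 0))
    (fun n hn => hord (n + 1) (by omega))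
  obtain ⟨hFm, hwm, hwm', hrm⟩ := hpkg (m - 1) (by omega)
  obtain ⟨hFm1, hwm1, hwm1', -⟩ := hpkg (m - 2) (by omega)
  rw [show m - 1 + 1 = m by omega] at hFm hrm hwm'
  rw [show m - 2 + 1 = m - 1 by omega] at hFm1 hwm1'
  -- `r_{j₁}(s m) = A`, hence `q ∤ A`, hence the column exponent `E` survives the cleaning
  have hrmj₁ : (s m).r j₁ = A := by rw [hrm j₁ hne, hr1j₁]
  rw [hrmj₁] at hq
  have hEF1 : E ∈ (s 1).F.support := by
    rw [MvPolynomial.mem_support_iff, hF1, coeff_deletePthPowers, if_neg]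
    · exact MvPolynomial.mem_support_iff.mp hEt
    · rw [isPthPowerExponent_iff]
      intro h
      exact hq (hEj₁ ▸ h j₁)
  have hF1ne : (s 1).F ≠ 0 := MvPolynomial.ne_zero_iff.mpr ⟨E, MvPolynomial.mem_support_iff.mp hEF1⟩
  -- the orders of `F_m` and `F_{m−1}` through the least package weights
  set Wm : ℕ := minPkgWeight j' m (s 1).F with hWm
  set Wm1 : ℕ := minPkgWeight j' (m - 1) (s 1).F with hWm1
  have hom : ordZero (s m).F = ((Wm - (m - 1) * q : ℕ) : ℕ∞) := by
    rw [hFm, ordZero_pkgTransform hF1ne hwm, show m - 1 + 1 = m by omega]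
  have hom1 : ordZero (s (m - 1)).F = ((Wm1 - (m - 2) * q : ℕ) : ℕ∞) := by
    rw [hFm1, ordZero_pkgTransform hF1ne hwm1, show m - 2 + 1 = m - 1 by omega]
  -- the multiplicities of `s m`
  have hsm : s m = step q j' 0 (s (m - 1)) := by
    have := hstep (m - 1) (by omega) (by omega)
    rwa [show m - 1 + 1 = m by omega] at this
  have hrmj' : (s m).r j' = Wm1 - (m - 2) * q - q := by
    rw [hsm]
    change newMult q j' 0 (s (m - 1)) j' = _
    rw [newMult_eq q j' 0 rfl (s (m - 1)) hom1, Finsupp.filter_apply,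
      if_pos (show (0 : σ → K) j' = 0 from rfl), Finsupp.update_apply, if_pos rfl]
  have hrmtwo : (s m).r.degree = (s m).r j₁ + (s m).r j' := degree_eq_two hne hσ (s m).r
  have hshadem : (s m).shade = ((Wm - (m - 1) * q - (s m).r.degree : ℕ) : ℕ∞) :=
    shade_eq_of_ordZero_eq _ hom
  -- ### the inequalities
  -- (K1) the column exponent bounds `W_m`
  have hK1 : Wm ≤ E j' + m * A := by
    have := minPkgWeight_le j' m hEF1
    rwa [pkgWeight_eq_two hne hσ' m E, hEj₁] at this
  -- `d*` realising `W_{m−1}`; (K3) concavity step; (K4) `y^{r(s 1)} ∣ F₁` at `d*`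
  obtain ⟨ds, hds, hdsW⟩ := exists_pkgWeight_eq_minPkgWeight j' (m - 1) hF1ne
  rw [pkgWeight_eq_two hne hσ' (m - 1) ds] at hdsW
  have hK3 : Wm ≤ ds j' + m * ds j₁ := by
    have := minPkgWeight_le j' m hds
    rwa [pkgWeight_eq_two hne hσ' m ds] at this
  have hK4 : (s 1).r j' ≤ ds j' := Finsupp.le_def.mp (hr1le ds hds) j'
  -- the weight bound `(m−1)·q ≤ W_{m−1}`
  have hdsW' : Wm1 = ds j' + (m - 1) * ds j₁ := hdsW.symm
  have hwt : (m - 1) * q ≤ Wm1 := by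
    have := hwm1' ds hds
    rwa [pkgWeight_eq_two hne hσ' (m - 1) ds, ← hdsW'] at this
  -- the column bound `E_{j'} ≤ r_{j'}(s 1) + σ₀`
  have hEtwo : E.degree = E j₁ + E j' := degree_eq_two hne hσ E
  have hcol : E j' ≤ (s 1).r j' + (o₀ - (s 0).r.degree) := by
    rw [hEtwo, hr1two, hr1j₁, hEj₁] at hEdeg; omega
  -- ### conclusion: the arithmetic of concavity
  rw [hshadem, hshade0, ← Nat.cast_mul, Nat.cast_le, hrmtwo, hrmj₁, hrmj']
  exact window_arith hm hdsW' hK3 hK1 hK4 hcol hwt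

/-! ## 3. Hauser's Fact: `shade(antelope) ≤ ⌊shade(oasis) / 2⌋` -/

omit [Fintype σ] in
/-- The step of a zero residual polynomial is zero. [folklore] -/
private theorem step_F_eq_zero_of_eq_zero (q : ℕ) (j : σ) (b : σ → K) (s : State σ K)
    (h : s.F = 0) : (step q j b s).F = 0 := by
  change deletePthPowers q (translate b (chartTransform q j s.F)) = 0
  rw [h, chartTransform_zero]
  unfold translate
  rw [map_zero, deletePthPowers_zero]

/-- One step at an equimultiple point of the exceptional divisor keeps the order `≥ q` and the
divisibility `y^r ∣ F`. [folklore] -/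
private theorem ord_and_dvd_step (q : ℕ) (j : σ) (b : σ → K) (hbj : b j = 0) (s : State σ K)
    (heq : IsEquimultiplePoint q j b s) (hr : ∀ d ∈ s.F.support, s.r ≤ d) :
    (q : ℕ∞) ≤ ordZero (step q j b s).F ∧
      ∀ d ∈ (step q j b s).F.support, (step q j b s).r ≤ d := by
  refine ⟨le_ordZero_step_of_isEquimultiplePoint q j b s heq, ?_⟩
  by_cases hF : s.F = 0
  · intro d hd
    rw [step_F_eq_zero_of_eq_zero q j b s hF, MvPolynomial.support_zero] at hd
    exact absurd hd (Finset.notMem_empty d)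
  · have hne : ordZero s.F ≠ ⊤ := by
      unfold ordZero
      rw [Ne, MvPowerSeries.order_eq_top_iff, MvPolynomial.coe_eq_zero_iff]
      exact hF
    obtain ⟨o, ho⟩ := WithTop.ne_top_iff_exists.mp hne
    exact newMult_le_of_mem_support_step q j b hbj s ho.symm hr

variable (p : ℕ) [hp : Fact p.Prime] [CharP K p]

/-- **Hauser's oasis–antelope Fact in the point-blow-up model** ([Hauser2010] §J p. 24: "The shade
of `f` drops between the oasis point `a°` and the antelope point `a` of a kangaroo point `a'` at least
to the integer part of its half, `shade_a f ≤ ⌊½·shade_{a°} f°⌋`"). Surfaces: two residual letters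
`j₁ ≠ j'` for `x^p + F(y_{j₁}, y_{j'})`, `char K = p`. The window from the oasis `s 0` to the
antelope `s m` has the forced shape (module docstring): `s 1 = step p j₁ b (s 0)` with `b_{j₁} = 0`,
then `m − 1 ≥ 1` blow-ups of the origin of the `y_{j'}`-chart, every step at an equimultiple point;
`y^r ∣ F` and order `≥ p` at the oasis; and `s m` is an antelope point: some kangaroo point
`(j, b')` lies above it. Then `Hauser2010.OasisBound (s 0).shade (s m).shade`, i.e.
**`2 · shade(s m) ≤ shade(s 0)`** — indeed `m · shade(s m) ≤ shade(s 0)`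
(`mul_shade_le_shade_of_window`), the hypothesis `p ∤ r_{j₁}(s m)` being the Kangaroo Theorem's
"both components are lost, both multiplicities prime to `p`"
(`lostComponents_eq_univ_of_shadeIncreases`). Model theorem (ours); the printed Fact refers to the
unpublished [Ha1]. [cite: Hauser2010, §J p. 24 (Fact)] -/
theorem shade_antelope_le_half_shade_oasis (hσ2 : Fintype.card σ = 2) {j₁ j' : σ} (hne : j₁ ≠ j')
    (hσ : ∀ l, l = j₁ ∨ l = j') (s : ℕ → State σ K) (b : σ → K) (hb : b j₁ = 0) {m : ℕ}
    (hm : 2 ≤ m) (h1 : s 1 = step p j₁ b (s 0))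
    (hstep : ∀ n, 1 ≤ n → n < m → s (n + 1) = step p j' 0 (s n))
    (heq1 : IsEquimultiplePoint p j₁ b (s 0))
    (heq : ∀ n, 1 ≤ n → n < m → IsEquimultiplePoint p j' 0 (s n))
    (hord0 : (p : ℕ∞) ≤ ordZero (s 0).F) (hr : ∀ d ∈ (s 0).F.support, (s 0).r ≤ d)
    {j : σ} {b' : σ → K} (hK : IsKangarooPoint p j b' (s m)) :
    Hauser2010.OasisBound (s 0).shade (s m).shade := by
  classical
  -- order `≥ p` and `y^r ∣ F` along the window
  have hmain : ∀ n, n ≤ m →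
      (p : ℕ∞) ≤ ordZero (s n).F ∧ ∀ d ∈ (s n).F.support, (s n).r ≤ d := by
    intro n hn
    induction n with
    | zero => exact ⟨hord0, hr⟩
    | succ k ih =>
      obtain ⟨-, hrk⟩ := ih (by omega)
      rcases Nat.eq_zero_or_pos k with rfl | hpos
      · rw [h1]
        exact ord_and_dvd_step p j₁ b hb (s 0) heq1 hr
      · rw [hstep k hpos (by omega)]
        exact ord_and_dvd_step p j' 0 rfl (s k) (heq k hpos (by omega)) hrk
  have hord : ∀ n, n ≤ m → (p : ℕ∞) ≤ ordZero (s n).F := fun n hn => (hmain n hn).1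
  obtain ⟨hordm, hrm⟩ := hmain m le_rfl
  -- the antelope state: clean, non-zero, natural order `≥ p`
  have hsm : s m = step p j' 0 (s (m - 1)) := by
    have := hstep (m - 1) (by omega) (by omega)
    rwa [show m - 1 + 1 = m by omega] at this
  have hclean : deletePthPowers p (s m).F = (s m).F := by
    rw [hsm]; exact deletePthPowers_step p j' 0 _
  have hFm : (s m).F ≠ 0 := by
    intro h0
    have hinc := hK.2.2
    unfold ShadeIncreases State.shade at hinc
    rw [h0, ordZero_zero, ENat.top_sub_coe] at hinc
    exact not_top_lt hinc
  have hne' : ordZero (s m).F ≠ ⊤ := by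
    unfold ordZero
    rw [Ne, MvPowerSeries.order_eq_top_iff, MvPolynomial.coe_eq_zero_iff]
    exact hFm
  obtain ⟨o, ho'⟩ := WithTop.ne_top_iff_exists.mp hne'
  have ho : ordZero (s m).F = o := ho'.symm
  have hpo : p ^ 1 ≤ o := by
    rw [pow_one]
    have h := hordm
    rw [ho] at h
    exact_mod_cast h
  -- the Kangaroo Theorem's bookkeeping: both multiplicities at the antelope point are prime to `p`
  obtain ⟨-, hndvd⟩ := lostComponents_eq_univ_of_shadeIncreases p hσ2 (e := 1) le_rfl j b' hK.1
    (s m) (by rw [pow_one]; exact hclean) ho hpo hrm (by rw [pow_one]; exact hK.2.2)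
  have hq : ¬ p ∣ (s m).r j₁ := by simpa [pow_one] using hndvd j₁
  -- the quantitative bound with `q = p`, then `2 ≤ m`
  have hmul := mul_shade_le_shade_of_window p hne hσ s b hb hm h1 hstep hord hr hq
  unfold Hauser2010.OasisBound
  have h2m : (2 : ℕ∞) ≤ (m : ℕ∞) := by exact_mod_cast hm
  calc (2 : ℕ∞) * (s m).shade ≤ (m : ℕ∞) * (s m).shade := by gcongr
    _ ≤ (s 0).shade := hmul

/-! ## 4. Non-vacuity: Hauser's walk of §K from the oasis to the antelope point, and the Fact on it

Hauser's example ([Hauser2010] §K; [Hauser2003] §14 Example 2): characteristic `2`,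
`f⁰ = x² + y⁷ + yz⁴` at the oasis `a⁰` (no exceptional divisor, `ord₀ F⁰ = 5`, shade `5`); the
blow-up of the origin read in the `y`-chart gives `f¹ = x² + y³(y² + z⁴)` (shade `5 − 3 = 2`), the next
one read in the `z`-chart gives the antelope point `f² = x² + y³z³(y² + z²)` (shade `8 − 6 = 2`), above
which lies the kangaroo point `a³` of `PointBlowupKangaroo.lean`. In the model: two steps at the
origins of the `y`- and `z`-charts take the state `(y⁷ + yz⁴, 0)` to the tree's antelope state
`(antelopeResidual, antelopeMult)`, every hypothesis of `shade_antelope_le_half_shade_oasis` holds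
along this window (`m = 2`), and the Fact reads `2·2 ≤ 5`. -/

section HauserK

variable (K : Type*) [Field K] [DecidableEq K]

/-- The chart exponent of `(a, c)` in the `y`-chart (`j = 0`, `q = 2`) is `(a + c − 2, c)`.
[cite: Hauser2010, §F (chart expressions)] -/
theorem chartExponent_fin_two_fst (a c : ℕ) :
    chartExponent 2 (0 : Fin 2) (Finsupp.single 0 a + Finsupp.single 1 c) =
      Finsupp.single 0 (a + c - 2) + Finsupp.single 1 c := by
  ext i
  rw [chartExponent_apply]
  fin_cases i <;> simp [Finsupp.degree_eq_sum, Fin.sum_univ_two]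

omit [DecidableEq K] in
/-- The oasis polynomial of [Hauser2010] §K as a binomial: `y⁷ + yz⁴ = y^{(7,0)} + y^{(1,4)}`.
[cite: Hauser2010, §K (f⁰ = x² + y⁷ + yz⁴)] -/
theorem hauserK_oasis_eq :
    (X 0 ^ 7 + X 0 * X 1 ^ 4 : MvPolynomial (Fin 2) K) =
      monomial (Finsupp.single 0 7 + Finsupp.single 1 0) 1 +
        monomial (Finsupp.single 0 1 + Finsupp.single 1 4) 1 := by
  rw [← X_pow_mul_X_pow, ← X_pow_mul_X_pow, pow_zero, mul_one, pow_one]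

omit [DecidableEq K] in
/-- `ord₀ (y⁷ + yz⁴) = 5`. [cite: Hauser2010, §K] -/
theorem ordZero_hauserK_oasis :
    ordZero (X 0 ^ 7 + X 0 * X 1 ^ 4 : MvPolynomial (Fin 2) K) = 5 := by
  rw [hauserK_oasis_eq, ordZero_binomial (single_add_single_ne (by norm_num))
    (by simp [Finsupp.degree_eq_sum, Fin.sum_univ_two])]
  simp [Finsupp.degree_eq_sum, Fin.sum_univ_two]

omit [DecidableEq K] in
/-- **The shade at the oasis point is `5`** (`F⁰ = y⁷ + yz⁴`, no exceptional divisor).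
[cite: Hauser2010, §K] -/
theorem shade_hauserK_oasis :
    (State.mk (X 0 ^ 7 + X 0 * X 1 ^ 4 : MvPolynomial (Fin 2) K) 0).shade = 5 := by
  rw [shade_eq_of_ordZero_eq _ (ordZero_hauserK_oasis K)]
  simp

/-- **The first blow-up of the §K walk in the model** (origin, `y`-chart): `(y⁷ + yz⁴, 0) ↦
(y⁵ + y³z⁴, (3, 0))` — Hauser's `f¹ = x² + y³(y² + z⁴)` with the new component `{y = 0}` of
multiplicity `ord₀ F⁰ − 2 = 3`. [cite: Hauser2010, §K (f¹ = x² + y³(y² + z⁴))] -/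
theorem step_hauserK_oasis :
    step 2 0 0 (State.mk (X 0 ^ 7 + X 0 * X 1 ^ 4 : MvPolynomial (Fin 2) K) 0) =
      State.mk (monomial (Finsupp.single 0 5 + Finsupp.single 1 0) 1 +
          monomial (Finsupp.single 0 3 + Finsupp.single 1 4) 1)
        (Finsupp.single 0 3) := by
  show State.mk (deletePthPowers 2 (pointTransform 2 0 0 _)) (newMult 2 0 0 _) = _
  simp only [State.mk.injEq]
  constructor
  · change deletePthPowers 2 (translate 0 (chartTransform 2 0
      (X 0 ^ 7 + X 0 * X 1 ^ 4 : MvPolynomial (Fin 2) K))) = _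
    rw [translate_zero, hauserK_oasis_eq,
      chartTransform_binomial 2 0 (single_add_single_ne (by norm_num)), chartExponent_fin_two_fst,
      chartExponent_fin_two_fst]
    exact deletePthPowers_binomial 2 (not_isPthPowerExponent_two_of_odd rfl 0)
      (not_isPthPowerExponent_two_of_odd rfl 4)
  · rw [newMult_eq 2 0 0 rfl _ (ordZero_hauserK_oasis K)]
    ext i
    fin_cases i <;> simp

/-- **The second blow-up of the §K walk in the model** (origin, `z`-chart): `(y⁵ + y³z⁴, (3,0)) ↦
(y⁵z³ + y³z⁵, (3, 3))` = the tree's antelope state `(antelopeResidual, antelopeMult)` — Hauser's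
`f² = x² + y³z³(y² + z²)`. [cite: Hauser2010, §K (f² = x² + y³z³(y² + z²))] -/
theorem step_step_hauserK_oasis :
    step 2 1 0 (step 2 0 0 (State.mk (X 0 ^ 7 + X 0 * X 1 ^ 4 : MvPolynomial (Fin 2) K) 0)) =
      State.mk (antelopeResidual K) antelopeMult := by
  rw [step_hauserK_oasis]
  have hord1 : ordZero (monomial (Finsupp.single 0 5 + Finsupp.single 1 0) (1 : K) +
      monomial (Finsupp.single 0 3 + Finsupp.single 1 4) 1 : MvPolynomial (Fin 2) K) = 5 := by
    rw [add_comm, ordZero_binomial (single_add_single_ne (by norm_num))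
      (by simp [Finsupp.degree_eq_sum, Fin.sum_univ_two])]
    simp [Finsupp.degree_eq_sum]
  show State.mk (deletePthPowers 2 (pointTransform 2 1 0 _)) (newMult 2 1 0 _) = _
  simp only [State.mk.injEq]
  constructor
  · change deletePthPowers 2 (translate 0 (chartTransform 2 1
      (monomial (Finsupp.single 0 5 + Finsupp.single 1 0) (1 : K) +
        monomial (Finsupp.single 0 3 + Finsupp.single 1 4) 1))) = _
    rw [translate_zero, chartTransform_binomial 2 1 (single_add_single_ne (by norm_num)),
      chartExponent_fin_two, chartExponent_fin_two, ← deletePthPowers_antelopeResidual K,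
      antelopeResidual_eq]
  · rw [newMult_eq 2 1 0 rfl _ hord1]
    ext i
    fin_cases i <;> simp [antelopeMult]

/-- **Hauser's Fact on Hauser's example, through the theorem** (non-vacuity of
`shade_antelope_le_half_shade_oasis`): in characteristic `2` the window `(y⁷ + yz⁴, 0) →
(y⁵ + y³z⁴, (3,0)) → (antelopeResidual, antelopeMult)` of the §K walk satisfies every hypothesis
(two origin steps in the `y`- then `z`-chart, equimultiple, order `≥ 2`, `y^r ∣ F`, and the
kangaroo point `(1, 0)` of the `z`-chart above the antelope state, `isKangarooPoint_antelope`), so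
`OasisBound 5 2`: "`shade_{a²} f² = 2 ≤ ⌊5/2⌋`". [cite: Hauser2010, §J (Fact), §K (example)] -/
theorem oasisBound_hauserK [CharP K 2] :
    Hauser2010.OasisBound
      (State.mk (X 0 ^ 7 + X 0 * X 1 ^ 4 : MvPolynomial (Fin 2) K) 0).shade
      (State.mk (antelopeResidual K) antelopeMult).shade := by
  classical
  -- the window as a sequence
  let S0 : State (Fin 2) K := State.mk (X 0 ^ 7 + X 0 * X 1 ^ 4) 0
  let s : ℕ → State (Fin 2) K :=
    fun n => if n = 0 then S0 else if n = 1 then step 2 0 0 S0 else step 2 1 0 (step 2 0 0 S0)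
  have hs0 : s 0 = S0 := rfl
  have hs1 : s 1 = step 2 0 0 (s 0) := rfl
  have hs2 : s 2 = State.mk (antelopeResidual K) antelopeMult := step_step_hauserK_oasis K
  have hstep : ∀ n, 1 ≤ n → n < 2 → s (n + 1) = step 2 1 0 (s n) := by
    intro n h1 h2
    obtain rfl : n = 1 := by omega
    rfl
  -- equimultiplicity of the two steps: the transforms are binomials of degrees `5, 7` and `8, 8`
  have hbin : ∀ {d d₁ d₂ : Fin 2 →₀ ℕ}, d₁ ≠ d₂ → 2 ≤ d₁.degree → 2 ≤ d₂.degree →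
      d.degree < 2 → coeff d (monomial d₁ (1 : K) + monomial d₂ 1) = 0 := by
    intro d d₁ d₂ hne h₁ h₂ hd
    by_contra h
    have hmem : d ∈ (monomial d₁ (1 : K) + monomial d₂ 1).support :=
      MvPolynomial.mem_support_iff.mpr h
    rw [support_binomial hne, Finset.mem_insert, Finset.mem_singleton] at hmem
    rcases hmem with rfl | rfl <;> omega
  have heq1 : IsEquimultiplePoint 2 (0 : Fin 2) 0 (s 0) := by
    intro d _ hd
    rw [hs0]
    change coeff d (translate 0 (chartTransform 2 0
      (X 0 ^ 7 + X 0 * X 1 ^ 4 : MvPolynomial (Fin 2) K))) = 0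
    rw [translate_zero, hauserK_oasis_eq,
      chartTransform_binomial 2 0 (single_add_single_ne (by norm_num)), chartExponent_fin_two_fst,
      chartExponent_fin_two_fst]
    exact hbin (single_add_single_ne (by norm_num)) (by simp [Finsupp.degree_eq_sum])
      (by simp [Finsupp.degree_eq_sum, Fin.sum_univ_two]) hd
  have heq : ∀ n, 1 ≤ n → n < 2 → IsEquimultiplePoint 2 (1 : Fin 2) 0 (s n) := by
    intro n h1 h2
    obtain rfl : n = 1 := by omega
    intro d _ hd
    rw [hs1, hs0, step_hauserK_oasis]
    change coeff d (translate 0 (chartTransform 2 1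
      (monomial (Finsupp.single 0 5 + Finsupp.single 1 0) (1 : K) +
        monomial (Finsupp.single 0 3 + Finsupp.single 1 4) 1))) = 0
    rw [translate_zero, chartTransform_binomial 2 1 (single_add_single_ne (by norm_num)),
      chartExponent_fin_two, chartExponent_fin_two]
    exact hbin (single_add_single_ne (by norm_num)) (by simp [Finsupp.degree_eq_sum, Fin.sum_univ_two])
      (by simp [Finsupp.degree_eq_sum, Fin.sum_univ_two]) hd
  have hord0 : ((2 : ℕ) : ℕ∞) ≤ ordZero (s 0).F := by
    rw [hs0]
    change ((2 : ℕ) : ℕ∞) ≤ ordZero (X 0 ^ 7 + X 0 * X 1 ^ 4 : MvPolynomial (Fin 2) K)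
    rw [ordZero_hauserK_oasis]
    exact_mod_cast (by norm_num : (2 : ℕ) ≤ 5)
  have hr : ∀ d ∈ (s 0).F.support, (s 0).r ≤ d := fun d _ => by
    rw [hs0]; exact Finsupp.le_def.mpr fun i => Nat.zero_le _
  have hK : IsKangarooPoint 2 1 ![(1 : K), 0] (s 2) := by
    rw [hs2]; exact isKangarooPoint_antelope K
  haveI : Fact (Nat.Prime 2) := ⟨Nat.prime_two⟩
  have h := shade_antelope_le_half_shade_oasis (σ := Fin 2) (K := K) 2 (by simp)
    (show (0 : Fin 2) ≠ 1 by decide) (fun l => by fin_cases l <;> simp) s 0 rfl (le_refl 2) hs1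
    hstep heq1 heq hord0 hr hK
  rwa [hs2, hs0] at h

end HauserK

/-! ## 5. The global form: along a run from a state with no exceptional divisor, every antelope
## point has shade at most half the initial shade

The oasis of [Hauser2010] §J is RELATIVE to the antelope point. Along an arbitrary run of point
blow-ups at equimultiple points of the successive exceptional divisors, started at a state with NO
exceptional component (`r = 0`), the window of §§2–3 is found by a backward scan (the maximal final
block of blow-ups of the origin of one chart, preceded by one blow-up read in the other chart — the
kernel form of the "forced shape" of the module docstring; the block cannot reach back to the start
because there `r = 0` while at the antelope point both multiplicities are prime to `p`), and the
initial shade dominates every later shade (an increase happens only at a kangaroo point, by at most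
`1` — Moh's bound `mohBound_one` — from an antelope shade `≤ ½·` an earlier shade, and the initial
shade is `ord₀ F₀ ≥ p ≥ 2`). Hence **`2·shade(s N) ≤ shade(s 0)` at EVERY antelope point `s N` of
such a run** (`shade_antelope_le_half_shade_start`), the form with "oasis := the start, `r = 0`". -/

section Global

omit [Fintype σ] in
/-- Along a block of blow-ups of the origin of the `y_c`-chart the other multiplicities do not
change. [folklore] -/
private theorem r_apply_eq_of_origin_block (q : ℕ) (s : ℕ → State σ K) {c c' : σ} (hc : c' ≠ c)
    {i N : ℕ} (hiN : i ≤ N) (hblk : ∀ n, i ≤ n → n < N → s (n + 1) = step q c 0 (s n)) :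
    (s N).r c' = (s i).r c' := by
  obtain ⟨d, rfl⟩ := Nat.exists_eq_add_of_le hiN
  induction d with
  | zero => rfl
  | succ d ih =>
    have h := hblk (i + d) (by omega) (by omega)
    rw [show i + (d + 1) = i + d + 1 by omega, h, step_origin_r_apply c (s (i + d)) hc]
    exact ih (by omega) (fun n hn hn' => hblk n hn (by omega))

variable (p : ℕ) [hp : Fact p.Prime] [CharP K p]

omit hp [CharP K p] in
/-- Run invariants up to step `N`: order `≥ p`, `y^r ∣ F`, and cleanliness, at every `s n`, `n ≤ N`.
[folklore] -/
private theorem run_invariants (s : ℕ → State σ K) (j : ℕ → σ) (b : ℕ → σ → K) {N : ℕ}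
    (hs : ∀ n, n < N → s (n + 1) = step p (j n) (b n) (s n)) (hb : ∀ n, n < N → b n (j n) = 0)
    (heq : ∀ n, n < N → IsEquimultiplePoint p (j n) (b n) (s n))
    (hclean0 : deletePthPowers p (s 0).F = (s 0).F) (hord0 : (p : ℕ∞) ≤ ordZero (s 0).F)
    (hr0 : ∀ d ∈ (s 0).F.support, (s 0).r ≤ d) :
    ∀ n, n ≤ N → (p : ℕ∞) ≤ ordZero (s n).F ∧ (∀ d ∈ (s n).F.support, (s n).r ≤ d) ∧
      deletePthPowers p (s n).F = (s n).F := by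
  intro n hn
  induction n with
  | zero => exact ⟨hord0, hr0, hclean0⟩
  | succ k ih =>
    obtain ⟨-, hrk, -⟩ := ih (by omega)
    rw [hs k (by omega)]
    obtain ⟨h1, h2⟩ := ord_and_dvd_step p (j k) (b k) (hb k (by omega)) (s k) (heq k (by omega)) hrk
    exact ⟨h1, h2, deletePthPowers_step p (j k) (b k) (s k)⟩

omit hp [CharP K p] in
/-- **The window of an antelope point (kernel form of the forced shape).** Two letters; a run
`s (n+1) = step q (j n) (b n) (s n)` (`n < N`) on the exceptional divisors (`b n (j n) = 0`) from a
state with `r = 0`; if at `s N` both multiplicities are prime to `q` (e.g. `s N` is an antelope point),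
then there is `t` with `1 ≤ t < N` such that the step into `s t` is read in a chart `j₁` and ALL the
steps from `s t` to `s N` are blow-ups of the origin of the other chart `j'`. [cite: Hauser2010, §J p. 24 (oasis and antelope points)] -/
theorem exists_window_of_not_dvd (q : ℕ) {y z : σ} (hyz : y ≠ z) (hσ : ∀ l, l = y ∨ l = z)
    (s : ℕ → State σ K) (j : ℕ → σ) (b : ℕ → σ → K) {N : ℕ}
    (hs : ∀ n, n < N → s (n + 1) = step q (j n) (b n) (s n)) (hb : ∀ n, n < N → b n (j n) = 0)
    (hr0 : (s 0).r = 0) (hnd : ∀ i, ¬ q ∣ (s N).r i) :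
    ∃ t j₁ j', j₁ ≠ j' ∧ (∀ l, l = j₁ ∨ l = j') ∧ 1 ≤ t ∧ t < N ∧ j (t - 1) = j₁ ∧
      ∀ n, t ≤ n → n < N → j n = j' ∧ b n = 0 := by
  classical
  -- `N ≥ 1`: at the start `r = 0`
  have hN : 1 ≤ N := by
    by_contra h
    have hN0 : N = 0 := by omega
    subst hN0
    exact hnd y (by rw [hr0]; simp)
  -- the chart `c` of the last step and the other letter `c'`
  set c : σ := j (N - 1) with hc
  obtain ⟨c', hc'c, hσc⟩ : ∃ c' : σ, c' ≠ c ∧ ∀ l, l = c' ∨ l = c := by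
    rcases hσ c with h | h
    · exact ⟨z, by rw [h]; exact hyz.symm, fun l => by
        rcases hσ l with hl | hl
        · exact Or.inr (hl.trans h.symm)
        · exact Or.inl hl⟩
    · exact ⟨y, by rw [h]; exact hyz, fun l => by
        rcases hσ l with hl | hl
        · exact Or.inl hl
        · exact Or.inr (hl.trans h.symm)⟩
  -- a lost `c'`-component contradicts `q ∤ r_{c'}(s N)`: the `c'`-multiplicity after a step in
  -- chart `c` at a point `b` with `b c' ≠ 0` is `0`
  have hlost : ∀ (u : State σ K) (b₀ : σ → K), b₀ c' ≠ 0 → (step q c b₀ u).r c' = 0 := by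
    intro u b₀ hb₀
    change newMult q c b₀ u c' = 0
    unfold newMult
    rw [Finsupp.update_apply, if_neg hc'c, Finsupp.filter_apply, if_neg hb₀]
  -- the backward scan: `Good i` = every step from `s i` to `s N` is an origin step in chart `c`
  let Good : ℕ → Prop := fun i => ∀ n, i ≤ n → n < N → j n = c ∧ b n = 0
  have hGoodN : Good N := fun n hn hn' => absurd hn' (not_lt.mpr hn)
  have hex : ∃ i, Good i := ⟨N, hGoodN⟩
  let t := Nat.find hex
  have hGt : Good t := Nat.find_spec hex
  have htN : t ≤ N := Nat.find_min' hex hGoodN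
  -- along the block, `r_{c'}` is constant
  have hblk : ∀ n, t ≤ n → n < N → s (n + 1) = step q c 0 (s n) := by
    intro n hn hn'
    obtain ⟨hj, hb0⟩ := hGt n hn hn'
    rw [hs n hn', hj, hb0]
  have hrN : (s N).r c' = (s t).r c' := r_apply_eq_of_origin_block q s hc'c htN hblk
  -- `t ≥ 1`
  have ht1 : 1 ≤ t := by
    by_contra h
    have ht0 : t = 0 := by omega
    apply hnd c'
    rw [hrN, ht0, hr0]
    simp
  -- the last step is an origin step in chart `c`: `Good (N − 1)`, so `t ≤ N − 1`
  have hsN : s N = step q c (b (N - 1)) (s (N - 1)) := by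
    have := hs (N - 1) (by omega)
    rwa [show N - 1 + 1 = N by omega] at this
  have hbN : b (N - 1) = 0 := by
    funext l
    rcases hσc l with hl | hl
    · rw [hl]
      by_contra hne
      apply hnd c'
      rw [hsN, hlost _ _ hne]
      simp
    · rw [hl]; exact hb (N - 1) (by omega)
  have hGoodN1 : Good (N - 1) := by
    intro n hn hn'
    obtain rfl : n = N - 1 := by omega
    exact ⟨rfl, hbN⟩
  have htN1 : t ≤ N - 1 := Nat.find_min' hex hGoodN1
  -- the step into `s t` is read in chart `c'`
  have hnotGood : ¬ Good (t - 1) := Nat.find_min hex (by omega)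
  have hjt : j (t - 1) = c' := by
    rcases hσc (j (t - 1)) with h | h
    · exact h
    · exfalso
      -- then `b (t − 1) ≠ 0`, hence `b (t − 1) c' ≠ 0`, and the `c'`-component is lost at `s t`
      have hbt : b (t - 1) ≠ 0 := by
        intro hb0
        apply hnotGood
        intro n hn hn'
        by_cases hnt : n = t - 1
        · subst hnt; exact ⟨h, hb0⟩
        · exact hGt n (by omega) hn'
      have hbtc' : b (t - 1) c' ≠ 0 := by
        intro h0
        apply hbt
        funext l
        rcases hσc l with hl | hl
        · rw [hl]; exact h0
        · rw [hl, ← h]; exact hb (t - 1) (by omega)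
      apply hnd c'
      have hst : s t = step q c (b (t - 1)) (s (t - 1)) := by
        have := hs (t - 1) (by omega)
        rwa [show t - 1 + 1 = t by omega, h] at this
      rw [hrN, hst, hlost _ _ hbtc']
      simp
  exact ⟨t, c', c, hc'c, hσc, ht1, by omega, hjt, fun n hn hn' => hGt n hn hn'⟩

/-- **Hauser's Fact, global form along a run from a bare start.** Two residual letters, `char K = p`;
a run `s (n+1) = step p (j n) (b n) (s n)` (`n < N`) of blow-ups at equimultiple points of the
successive exceptional divisors (`b n (j n) = 0`), started at a CLEAN state of order `≥ p` with NO
exceptional component (`(s 0).r = 0` — "oasis := the start"). Then at every antelope point `s N` of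
the run (a kangaroo point `(c, b')` lies above it): `Hauser2010.OasisBound (s 0).shade (s N).shade`,
i.e. **`2·shade(s N) ≤ shade(s 0)`**. Proof: the window of `exists_window_of_not_dvd` ends at `s N`
and starts at some `s (t−1)`, so `2·shade(s N) ≤ shade(s (t−1))` by
`shade_antelope_le_half_shade_oasis`; and `shade(s k) ≤ shade(s 0)` for all `k ≤ N` by induction —
a step that is not a kangaroo point does not increase the shade, a kangaroo step raises it by at most
`1` (Moh's bound, `mohBound_one`) from an antelope shade `≤ ½·shade(s 0)`, and
`shade(s 0) = ord₀ F₀ ≥ p ≥ 2`. Model theorem (ours). [cite: Hauser2010, §J p. 24 (Fact)]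
[cite: Moh1987, Stability Theorem (the bound +1 at order p)] -/
theorem shade_antelope_le_half_shade_start (hσ2 : Fintype.card σ = 2) {y z : σ} (hyz : y ≠ z)
    (hσ : ∀ l, l = y ∨ l = z) (s : ℕ → State σ K) (j : ℕ → σ) (b : ℕ → σ → K) {N : ℕ}
    (hs : ∀ n, n < N → s (n + 1) = step p (j n) (b n) (s n)) (hb : ∀ n, n < N → b n (j n) = 0)
    (heq : ∀ n, n < N → IsEquimultiplePoint p (j n) (b n) (s n))
    (hclean0 : deletePthPowers p (s 0).F = (s 0).F) (hord0 : (p : ℕ∞) ≤ ordZero (s 0).F)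
    (hr0 : (s 0).r = 0) {c : σ} {b' : σ → K} (hK : IsKangarooPoint p c b' (s N)) :
    Hauser2010.OasisBound (s 0).shade (s N).shade := by
  classical
  have hr0' : ∀ d ∈ (s 0).F.support, (s 0).r ≤ d := fun d _ => by
    rw [hr0]; exact Finsupp.le_def.mpr fun i => Nat.zero_le _
  -- the initial shade: `⊤` (then everything is trivial) or a natural `σ₀ ≥ p ≥ 2`
  unfold Hauser2010.OasisBound
  by_cases hF0 : (s 0).F = 0
  · have : (s 0).shade = ⊤ := by
      unfold State.shade; rw [hF0, ordZero_zero, ENat.top_sub_coe]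
    rw [this]; exact le_top
  have hne0 : ordZero (s 0).F ≠ ⊤ := by
    unfold ordZero
    rw [Ne, MvPowerSeries.order_eq_top_iff, MvPolynomial.coe_eq_zero_iff]
    exact hF0
  obtain ⟨o₀, ho₀'⟩ := WithTop.ne_top_iff_exists.mp hne0
  have ho₀ : ordZero (s 0).F = o₀ := ho₀'.symm
  have hpo₀ : p ≤ o₀ := by have h := hord0; rw [ho₀] at h; exact_mod_cast h
  have hp2 : 2 ≤ p := hp.out.two_le
  have hshade0 : (s 0).shade = (o₀ : ℕ∞) := by
    rw [shade_eq_of_ordZero_eq _ ho₀, hr0]; simp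
  rw [hshade0]
  -- ### the two claims, by strong induction on the index: the envelope and the antelope bound
  -- WINDOW BOUND at any index `M ≤ N` carrying a kangaroo point, GIVEN the envelope below `M`
  have hwin : ∀ M, M ≤ N → (∀ k, k < M → (s k).shade ≤ (o₀ : ℕ∞)) →
      ∀ c₁ (b₁ : σ → K), IsKangarooPoint p c₁ b₁ (s M) → 2 * (s M).shade ≤ (o₀ : ℕ∞) := by
    intro M hMN henv c₁ b₁ hK₁
    -- run facts up to `M`
    have hsM : ∀ n, n < M → s (n + 1) = step p (j n) (b n) (s n) := fun n hn => hs n (by omega)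
    have hbM : ∀ n, n < M → b n (j n) = 0 := fun n hn => hb n (by omega)
    have heqM : ∀ n, n < M → IsEquimultiplePoint p (j n) (b n) (s n) := fun n hn => heq n (by omega)
    have hinv := run_invariants p s j b hsM hbM heqM hclean0 hord0 hr0'
    obtain ⟨hordM, hrM, hcleanM⟩ := hinv M le_rfl
    -- both multiplicities at `s M` are prime to `p`
    have hFM : (s M).F ≠ 0 := by
      intro h0
      have hinc := hK₁.2.2
      unfold ShadeIncreases State.shade at hinc
      rw [h0, ordZero_zero, ENat.top_sub_coe] at hinc
      exact not_top_lt hinc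
    have hneM : ordZero (s M).F ≠ ⊤ := by
      unfold ordZero
      rw [Ne, MvPowerSeries.order_eq_top_iff, MvPolynomial.coe_eq_zero_iff]
      exact hFM
    obtain ⟨oM, hoM'⟩ := WithTop.ne_top_iff_exists.mp hneM
    have hoM : ordZero (s M).F = oM := hoM'.symm
    have hpoM : p ^ 1 ≤ oM := by rw [pow_one]; have h := hordM; rw [hoM] at h; exact_mod_cast h
    obtain ⟨-, hnd⟩ := lostComponents_eq_univ_of_shadeIncreases p hσ2 (e := 1) le_rfl c₁ b₁ hK₁.1
      (s M) (by rw [pow_one]; exact hcleanM) hoM hpoM hrM (by rw [pow_one]; exact hK₁.2.2)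
    have hnd' : ∀ i, ¬ p ∣ (s M).r i := fun i => by simpa [pow_one] using hnd i
    -- the window
    obtain ⟨t, j₁, j', hne, hσ', ht1, htM, hjt, hblk⟩ :=
      exists_window_of_not_dvd p hyz hσ s j b hsM hbM hr0 hnd'
    -- the shifted sequence `u k = s (t − 1 + k)`, window length `m = M − t + 1 ≥ 2`
    set u : ℕ → State σ K := fun k => s (t - 1 + k) with hu
    have hu0 : u 0 = s (t - 1) := by simp [hu]
    have hu1 : u 1 = step p j₁ (b (t - 1)) (u 0) := by
      have := hs (t - 1) (by omega)
      rw [hjt] at this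
      simpa [hu, show t - 1 + 1 = t by omega] using this
    have hustep : ∀ n, 1 ≤ n → n < M - t + 1 → u (n + 1) = step p j' 0 (u n) := by
      intro n hn hn'
      obtain ⟨hj, hb0⟩ := hblk (t - 1 + n) (by omega) (by omega)
      have := hs (t - 1 + n) (by omega)
      rw [hj, hb0] at this
      simpa [hu, show t - 1 + (n + 1) = t - 1 + n + 1 by omega] using this
    have hueq1 : IsEquimultiplePoint p j₁ (b (t - 1)) (u 0) := by
      rw [hu0, ← hjt]; exact heq (t - 1) (by omega)
    have hueq : ∀ n, 1 ≤ n → n < M - t + 1 → IsEquimultiplePoint p j' 0 (u n) := by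
      intro n hn hn'
      obtain ⟨hj, hb0⟩ := hblk (t - 1 + n) (by omega) (by omega)
      have := heq (t - 1 + n) (by omega)
      rw [hj, hb0] at this
      simpa [hu] using this
    obtain ⟨huord0, hur0, -⟩ := hinv (t - 1) (by omega)
    have huK : IsKangarooPoint p c₁ b₁ (u (M - t + 1)) := by
      simpa [hu, show t - 1 + (M - t + 1) = M by omega] using hK₁
    have hfact := shade_antelope_le_half_shade_oasis p hσ2 hne hσ' u (b (t - 1))
      (by rw [← hjt]; exact hb (t - 1) (by omega)) (m := M - t + 1) (by omega) hu1 hustep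
      (by rw [hu0]; exact hueq1) hueq (by rw [hu0]; exact huord0) (by rw [hu0]; exact hur0) huK
    unfold Hauser2010.OasisBound at hfact
    have hM' : u (M - t + 1) = s M := by simp [hu, show t - 1 + (M - t + 1) = M by omega]
    rw [hM', hu0] at hfact
    exact hfact.trans (henv (t - 1) (by omega))
  -- the ENVELOPE `shade(s k) ≤ o₀` for all `k ≤ N`, by induction
  have henv : ∀ k, k ≤ N → (s k).shade ≤ (o₀ : ℕ∞) := by
    intro k
    induction k using Nat.strong_induction_on with
    | _ k ih =>
      intro hk
      rcases Nat.eq_zero_or_pos k with rfl | hkpos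
      · rw [hshade0]
      have hprev : ∀ i, i < k → (s i).shade ≤ (o₀ : ℕ∞) := fun i hi => ih i hi (by omega)
      have hsk : s k = step p (j (k - 1)) (b (k - 1)) (s (k - 1)) := by
        have := hs (k - 1) (by omega)
        rwa [show k - 1 + 1 = k by omega] at this
      by_cases hinc : ShadeIncreases p (j (k - 1)) (b (k - 1)) (s (k - 1))
      · -- a kangaroo point at `s (k − 1)`: window bound there, then Moh's `+1`
        have hKk : IsKangarooPoint p (j (k - 1)) (b (k - 1)) (s (k - 1)) :=
          ⟨hb (k - 1) (by omega), heq (k - 1) (by omega), hinc⟩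
        have h2 := hwin (k - 1) (by omega) (fun i hi => hprev i (by omega)) _ _ hKk
        obtain ⟨hordk, hrk, hcleank⟩ :=
          run_invariants p s j b (N := k - 1) (fun n hn => hs n (by omega))
            (fun n hn => hb n (by omega)) (fun n hn => heq n (by omega)) hclean0 hord0 hr0'
            (k - 1) le_rfl
        have hmoh := mohBound_one p (j (k - 1)) (b (k - 1)) (hb (k - 1) (by omega)) (s (k - 1))
          hcleank hordk hrk
        unfold MohBound at hmoh
        rw [pow_one, Nat.sub_self, pow_zero, Nat.cast_one] at hmoh
        rw [hsk]
        -- `x := shade(s (k−1))` is finite with `2x ≤ o₀`, and the new shade is `≤ x + 1 ≤ o₀`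
        have hx : (s (k - 1)).shade ≠ ⊤ :=
          ne_top_of_le_ne_top WithTop.coe_ne_top (hprev (k - 1) (by omega))
        obtain ⟨x, hx'⟩ := WithTop.ne_top_iff_exists.mp hx
        rw [← hx'] at h2 hmoh
        have h2' : 2 * x ≤ o₀ := by
          have h2c : ((2 * x : ℕ) : ℕ∞) ≤ (o₀ : ℕ∞) := by rwa [Nat.cast_mul, Nat.cast_ofNat]
          exact_mod_cast h2c
        have : ((x : ℕ∞) + 1) ≤ (o₀ : ℕ∞) := by
          have : x + 1 ≤ o₀ := by omega
          exact_mod_cast this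
        exact hmoh.trans this
      · -- no increase
        rw [hsk]
        exact (not_lt.mp hinc).trans (hprev (k - 1) (by omega))
  exact hwin N le_rfl (fun k hk => henv k (by omega)) c b' hK

end Global

end PointBlowup

end Literature.AlgebraicGeometry.Resolution

end
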